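import Summits.BirchSwinnertonDyer.BirchSwinnertonDyer.Theorems.PrintCf2RamifiedOffTYZMoverSquaresSix
import Summits.BirchSwinnertonDyer.BirchSwinnertonDyer.Theorems.PrintCf2RamifiedOffTYZMoverBlockCharacterSix
import Summits.BirchSwinnertonDyer.BirchSwinnertonDyer.Theorems.PrintCf2RamifiedOffTYZLevelTwoTwoPrimesEven
import Literature.NumberTheory.QuadraticFields.FourRankOneKernelCriterion
import HarnessLib

/-!
# Crux `PrintCf2.RamifiedOffTYZOfFacts` (stmt-BirchSwinnertonDyer-20509), line `offtyz-v7`, LEAD cycle 13 (cruxlead-20509 g12):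
# SQUARE SILENCE ON THE EVEN TWO-PRIME JUMP-ONE CLASS `n = 2lq` — an `L_d(i)`-trivial involution outside `Gal(ℍ′_n/H_d)` kills the
# square-power character of a CM block, and on `n = 2lq` with `#Sel₂(E_n) = 2⁵` the Frobenius involution of `𝔭_l` is such a witness

THEOREMS ONLY (no `def`, no named fact, no `sorry`), `--supports stmt-BirchSwinnertonDyer-20509` (C⁺ = item 23431 `RamifiedJumpOneLevelTwoOfFacts`,
its EVEN two-prime sectors E1/E2).  The even twin of g10's `…LayerOneSilenceOdd` (p722669), which was odd-only: for even `n` the block characters of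
the blocks `d ≡ 6 (mod 8)` outside the genus regime are not display-determined (LEAD g9/g10), and on the jump-one class the top block is NEVER in the
genus regime (`g(n)` even; e.g. `Cl(ℚ(√−646))[2^∞] ≅ ℤ/8 × ℤ/2`).  This file removes the obstruction for `k = 2`:

* §1 **Transfer lemma** (`not_sqChi_of_trivialOnL_involution`, every CM block `d ≡ 5, 6 (mod 8)`): if some automorphism `e` of `ℍ′_n` is trivial on
  `L_d(i)`, has `e·e ∈ Gal(ℍ′_n/H′_d)` and `e ∉ Gal(ℍ′_n/H_d)`, then `(g·g)^{g(d)} ≢ σ_d` for EVERY automorphism `g`.  Proof: in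
  `Gal(H′_d/ℚ) = Aut(ℍ′_n)/Gal(ℍ′_n/H′_d)` the classes of the `L_d(i)`-trivial elements form the abelian group `2Cl′_d = Φ̄₀ ⊔ Φ̄₀σ̄` of order `2g(d)`
  ((G1), (G3), (G7)); `ḡ²` lies in it, and `(ḡ²)^{g(d)} = σ̄` would make `σ̄` its unique involution (`FourRankOne.eq_one_or_eq_of_pow_eq`: an `m`-th
  root of an involution in an abelian group of order `2m`), contradicting `ē ∉ {1, σ̄}`.
* §2 **Top-block reduction on `n = 2lq`** (`l ≡ 1 (mod 8)`, `q ≡ 3 (mod 4)`; g8's `galPt_mul_self_P_eq_add_even`): no divisor of `n` is `≡ 5 (mod 8)`,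
  the blocks `q, lq` are `≡ 3, 7`, and the one proper block `2q ≡ 6` carries the coefficient `|𝓛(l)|`, EVEN (Thm 1.1 with Monsky: `s(l) = 2`) — so
  `g·g·P(n) = P(n) + [g(√−n) = √−n ∧ (g·g)^{g(n)} ≡ σ_n]·τ(1)` (`galPt_mul_self_P_eq_add_top_two_primes`), and a witness as in §1 for the TOP block gives
  `g·g·P(n) = P(n)` for all `g` (`galPt_sq_genusPoint_eq_of_witness`).
* §3 **The witness on the `s = 3` class** (`(l/q) = 1`, i.e. `#Sel₂(E_{2lq}) = 2⁵` among `n = 2lq ≡ 6 (mod 8)`, Monsky): the Frobenius element `φ_l` of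
  the ramified prime `𝔭_l` in `ℍ′_n/K_n` (conductor-`4` clause (F1)–(F3) of `FrobeniusFourBlockSpec`, Euler's criterion: `(−1/l) = (−2/l) = 1`,
  `(−q/l) = (l/q) = 1`) is trivial on `L_n(i)` (`trivialOnL_of_frobenius_clause`) and squares into `Gal(ℍ′_n/H′_n)` (F2); with the ONE extra printed
  sentence (F5) «`φ_l ∉ Gal(ℍ′_n/H_n)`» (Artin reciprocity for the Hilbert class field: `φ_l|_{H_n} = ((H_n/K_n)/𝔭_l) ≠ 1` because `𝔭_l` is not
  principal — `x² + 2lq·y² = l` has no solution) §1–§2 give **`g·g·P(n) = P(n)` for every `g ∈ Gal(ℍ′_n/ℚ)`** (`galPt_sq_genusPoint_eq_two_primes_even`).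
  (F5) is carried as an explicit hypothesis, display-shaped, pending its typing next to `FrobeniusFourBlockSpec` (the display deliberately omits the
  Frobenius normalisation of `ρ₄`; without (F5) the clause (F1)–(F3) at `q := l` is witnessed by the identity on this class).

LEAD census (crux workfile `Lines/offtyz_v7_EvenTwoPrimes.md`): for all 785 square-free `n = 2lq ≡ 6 (8)`, `n ≤ 16000`, «`σ_n ∈ Pic(𝒪₄(ℚ(√−n)))^{2g(n)}`»
⟺ `#Sel₂(E_n) = 8`.  Consumer: `…LowerHalfTwoPrimesEven` (the LOWER HALF `2 ∣ 𝓛(n)` on E1 ∪ E2).  BSD is not proved by any of this; no class is closed.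

References: [cite: TianYuanZhang2017, §3.1 (p0011 L1–L13, L53–L73), Prop. 3.2 (2) (p0010 L111–L113), Thm. 3.6 (2), proof of Lemma 3.21 (p0020 L27–L63),
Thm. 1.1]; [cite: Cox2013, §5.C Lemma 5.19, (5.20), (5.22), Cor. 5.21, §9.A (pp. 180–181), §1 (1.13)–(1.15)]; [cite: Rotman1995, Thm. 2.19 (PDF p. 37)];
[cite: HeathBrown1994SelmerCongruentII, Appendix (Monsky)]; tree: g8 `…MoverSquaresSix`, `…MoverBlockCharacterSix`, g10 `…LevelTwoTwoPrimesEven`,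
ty2 `FourRankOneKernelCriterion`.
-/

noncomputable section

open scoped Classical

open WeierstrassCurve WeierstrassCurve.Affine Finset Literature.NumberTheory.EllipticCurves
  Literature.NumberTheory.EllipticCurves.TianYuanZhang2017
  Literature.NumberTheory.EllipticCurves.TianYuanZhang2017.W2
  Summit.BirchSwinnertonDyer.Rank1Residual.P2.GenusPeriodTransferLayer
  Summit.BirchSwinnertonDyer.Rank1Residual.P2
  Summit.BirchSwinnertonDyer.PrintCf2.MoverAssembly

set_option autoImplicit false

namespace Summit.BirchSwinnertonDyer.PrintCf2.SquareSilenceEven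

variable {n : ℕ} (D : GenusPointData n)

/-! ## §1 The transfer lemma: a square `L_d(i)`-trivial involution class outside `Gal(ℍ′_n/H_d)` kills the square-power character -/

/-- **An `L_d(i)`-trivial automorphism `e` with `e² ∈ Gal(ℍ′_n/H′_d)` and `e ∉ Gal(ℍ′_n/H_d)` forces `(g·g)^{g(d)} ≢ σ` for EVERY
automorphism `g` of `ℍ′_n`** (block `d ≡ 5, 6 (mod 8)` of the CM-point display).  In the quotient `Gal(H′_d/ℚ) = Aut(ℍ′_n)/Gal(ℍ′_n/H′_d)`
the classes of the `L_d(i)`-trivial elements form the abelian group `2Cl′_d` of order `2·#Φ₀ = 2g(d)` ((G7): `Φ₀ ⊔ Φ₀σ̄`, exactly once);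
`y := ḡ²` lies in it, and `y^{g(d)} = σ̄ ≠ 1` would make `σ̄` its ONLY involution (an `m`-th root of an involution in an abelian group of order
`2m`: `FourRankOne.eq_one_or_eq_of_pow_eq`), whereas `ē ≠ 1, σ̄` is another one.
[cite: TianYuanZhang2017, §3.1 (p0011 L1–L13: Cl′, 2Cl′, Φ₀), Prop. 3.2 (1)(2), proof of Lemma 3.21 (p0020 L55–L62)]
[cite: Rotman1995, Thm. 2.19 (PDF p. 37)] -/
theorem not_sqChi_of_trivialOnL_involution {d : ℕ} (hd : d ∈ n.divisors) (hd1 : 1 < d)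
    {z : APoint D.H} {Φ : Finset (D.H ≃ₐ[ℚ] D.H)} {ΓH ΓH' : Subgroup (D.H ≃ₐ[ℚ] D.H)} {σ c : D.H ≃ₐ[ℚ] D.H}
    (h : D.CMBlockSpec d z Φ ΓH ΓH' σ c) {e : D.H ≃ₐ[ℚ] D.H} (heL : D.TrivialOnL d e) (hee : e * e ∈ ΓH')
    (heH : e ∉ ΓH) (g : D.H ≃ₐ[ℚ] D.H) : (g * g) ^ gK d * σ⁻¹ ∉ ΓH' := by
  intro hχ
  have hσΓ' : σ ∉ ΓH' := sigma_not_mem D ΓH' z σ h.2.2.1.1 h.2.2.2.2.2.1.2.2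
  obtain ⟨⟨-, hcard⟩, hΦL, ⟨-, hΓn, hcomm⟩, ⟨hΓ'Γ, -⟩, -, ⟨hσΓ, hσσ, -⟩, hrep, huniq⟩ := h
  have hdd : d ∈ d.divisors := Nat.mem_divisors_self d (by omega)
  have hK : ∀ x : D.H ≃ₐ[ℚ] D.H, D.TrivialOnL d x → x (D.sqrtNeg d) = D.sqrtNeg d := fun x hx => hx.2 d hdd hd1
  haveI hN : ΓH'.Normal := ⟨fun γ hγ x => hΓn x γ hγ⟩
  set φ := QuotientGroup.mk' ΓH' with hφ
  have hone : ∀ x : D.H ≃ₐ[ℚ] D.H, φ x = 1 ↔ x ∈ ΓH' := fun x => by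
    rw [hφ, QuotientGroup.mk'_apply, QuotientGroup.eq_one_iff]
  have hφmem : ∀ x y : D.H ≃ₐ[ℚ] D.H, x * y⁻¹ ∈ ΓH' ↔ φ x = φ y := fun x y => mul_inv_mem_iff_mk_eq ΓH' x y
  have hφcomm : ∀ s t : D.H ≃ₐ[ℚ] D.H, s (D.sqrtNeg d) = D.sqrtNeg d → t (D.sqrtNeg d) = D.sqrtNeg d →
      φ s * φ t = φ t * φ s := by
    intro s t hs ht
    have h1 : φ (s⁻¹ * t⁻¹ * s * t) = 1 := (hone _).mpr (hcomm s t hs ht)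
    rw [map_mul, map_mul, map_mul, map_inv, map_inv] at h1
    calc φ s * φ t = φ t * φ s * ((φ s)⁻¹ * (φ t)⁻¹ * φ s * φ t) := by group
      _ = φ t * φ s := by rw [h1, mul_one]
  have hκ1 : φ σ ≠ 1 := fun e1 => hσΓ' ((hone σ).mp e1)
  have hκκ : φ σ * φ σ = 1 := by rw [← map_mul]; exact (hone _).mpr hσσ
  -- the subgroup of `L_d(i)`-trivial automorphisms and its image `S = 2Cl′_d`
  let T₀ : Subgroup (D.H ≃ₐ[ℚ] D.H) :=
    { carrier := {x | D.TrivialOnL d x}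
      mul_mem' := fun ha hb => trivialOnL_mul D ha hb
      one_mem' := trivialOnL_one D d
      inv_mem' := fun ha => trivialOnL_inv D ha }
  have hT₀ : ∀ x, x ∈ T₀ ↔ D.TrivialOnL d x := fun _ => Iff.rfl
  set S : Subgroup ((D.H ≃ₐ[ℚ] D.H) ⧸ ΓH') := T₀.map φ with hS
  have hSmem : ∀ u, u ∈ S ↔ ∃ x, D.TrivialOnL d x ∧ φ x = u := fun u => by
    rw [hS, Subgroup.mem_map]; rfl
  -- `y = φ(g g) ∈ S` with `y^{g(d)} = φ σ`; hence `φ σ ∈ S`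
  have hyS : φ (g * g) ∈ S := (hSmem _).mpr ⟨g * g, trivialOnL_mul_self_of_mem_divisors D g hd, rfl⟩
  have hy : φ (g * g) ^ gK d = φ σ := by rw [← map_pow]; exact ((hφmem _ _).mp hχ)
  have hσS : φ σ ∈ S := by rw [← hy]; exact S.pow_mem hyS _
  have heS : φ e ∈ S := (hSmem _).mpr ⟨e, heL, rfl⟩
  -- `S` is commutative
  letI : CommGroup S :=
    { (inferInstance : Group S) with
      mul_comm := fun a b => by
        obtain ⟨xa, hxa, ha⟩ := (hSmem a.1).mp a.2
        obtain ⟨xb, hxb, hb⟩ := (hSmem b.1).mp b.2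
        apply Subtype.ext
        change a.1 * b.1 = b.1 * a.1
        rw [← ha, ← hb]
        exact hφcomm xa xb (hK xa hxa) (hK xb hxb) }
  -- `#S = 2 g(d)`: `S = Φ̄ ⊔ Φ̄·σ̄` (exactly once)
  set F : Finset ((D.H ≃ₐ[ℚ] D.H) ⧸ ΓH') := Φ.image (fun r => φ r) ∪ Φ.image (fun r => φ r * φ σ) with hF
  have hinj1 : Set.InjOn (fun r => φ r) ↑Φ := by
    intro r₁ hr₁ r₂ hr₂ h12
    exact huniq r₁ hr₁ r₂ hr₂ (Or.inl ((hφmem r₁ r₂).mpr h12))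
  have hinj2 : Set.InjOn (fun r => φ r * φ σ) ↑Φ := by
    intro r₁ hr₁ r₂ hr₂ h12
    exact huniq r₁ hr₁ r₂ hr₂ (Or.inl ((hφmem r₁ r₂).mpr (mul_right_cancel h12)))
  have hdisj : Disjoint (Φ.image (fun r => φ r)) (Φ.image (fun r => φ r * φ σ)) := by
    rw [Finset.disjoint_left]
    intro u hu1 hu2
    obtain ⟨r₁, hr₁, e1⟩ := Finset.mem_image.mp hu1
    obtain ⟨r₂, hr₂, e2⟩ := Finset.mem_image.mp hu2
    have h12 : φ r₁ = φ (r₂ * σ) := by rw [map_mul, e2]; exact e1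
    have hr : r₁ = r₂ := huniq r₁ hr₁ r₂ hr₂ (Or.inr ((hφmem r₁ (r₂ * σ)).mpr h12))
    rw [hr, map_mul] at h12
    exact hκ1 (mul_left_cancel (a := φ r₂) (by rw [mul_one]; exact h12)).symm
  have hFcard : F.card = 2 * gK d := by
    rw [hF, Finset.card_union_of_disjoint hdisj, Finset.card_image_of_injOn hinj1, Finset.card_image_of_injOn hinj2, hcard]
    ring
  have hSF : (S : Set ((D.H ≃ₐ[ℚ] D.H) ⧸ ΓH')) = ↑F := by
    ext u
    rw [SetLike.mem_coe, hSmem, hF, Finset.coe_union, Finset.coe_image, Finset.coe_image, Set.mem_union, Set.mem_image,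
      Set.mem_image]
    constructor
    · rintro ⟨x, hx, rfl⟩
      obtain ⟨t, ht, hxt | hxt⟩ := hrep x hx
      · exact Or.inl ⟨t, Finset.mem_coe.mpr ht, ((hφmem x t).mp hxt).symm⟩
      · refine Or.inr ⟨t, Finset.mem_coe.mpr ht, ?_⟩
        rw [← map_mul]; exact ((hφmem x (t * σ)).mp hxt).symm
    · rintro (⟨t, ht, rfl⟩ | ⟨t, ht, rfl⟩)
      · exact ⟨t, hΦL t (Finset.mem_coe.mp ht), rfl⟩
      · have htS : φ t ∈ S := (hSmem _).mpr ⟨t, hΦL t (Finset.mem_coe.mp ht), rfl⟩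
        exact (hSmem _).mp (S.mul_mem htS hσS)
  have hScard : Nat.card S = 2 * gK d := by
    rw [← SetLike.coe_sort_coe, hSF, Finset.coe_sort_coe, Nat.card_eq_finsetCard, hFcard]
  have hg0 : 0 < gK d := by
    obtain ⟨t₀, ht₀, -⟩ := hrep 1 (trivialOnL_one D d)
    rw [← hcard]
    exact Finset.card_pos.mpr ⟨t₀, ht₀⟩
  haveI : Finite S := Nat.finite_of_card_ne_zero (by rw [hScard]; omega)
  -- the transfer lemma in `S`
  have hκ1' : (⟨φ σ, hσS⟩ : S) ≠ 1 := fun e1 => hκ1 (congrArg Subtype.val e1 :)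
  have hκ2' : (⟨φ σ, hσS⟩ : S) ^ 2 = 1 := Subtype.ext (by
    change φ σ ^ 2 = 1
    rw [sq]; exact hκκ)
  have hx' : (⟨φ (g * g), hyS⟩ : S) ^ gK d = ⟨φ σ, hσS⟩ := Subtype.ext (by
    change φ (g * g) ^ gK d = φ σ
    exact hy)
  have hs' : (⟨φ e, heS⟩ : S) ^ 2 = 1 := Subtype.ext (by
    change φ e ^ 2 = 1
    rw [sq, ← map_mul]; exact (hone _).mpr hee)
  have key := Literature.NumberTheory.QuadraticFields.FourRankOne.eq_one_or_eq_of_pow_eq (S := S) (m := gK d) hScard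
    hκ1' hκ2' hx' ⟨φ e, heS⟩ hs'
  rcases key with h1 | h1
  · exact heH (hΓ'Γ e ((hone e).mp (congrArg Subtype.val h1 :)))
  · have hmem : e * σ⁻¹ ∈ ΓH' := (hφmem e σ).mpr (congrArg Subtype.val h1 :)
    apply heH
    have : e = (e * σ⁻¹) * σ := by group
    rw [this]
    exact ΓH.mul_mem (hΓ'Γ _ hmem) hσΓ

/-! ## §2 The two-prime even sector `n = 2lq`: every proper block drops, the square motion of `P(n)` is the top-block bit -/

/-- For `n = 2lq` with `l ≡ 1 (mod 8)` and `q ≡ 3 (mod 4)` no divisor of `n` is `≡ 5 (mod 8)` (the divisors are `1, 2, l, q, 2l, 2q, lq, 2lq ≡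
1, 2, 1, q, 2, 6, q, 6` with `q ≡ 3, 7`). [cite: TianYuanZhang2017, §3.1 (p0011 L67–L70)] -/
theorem mod_eight_ne_five_of_dvd {l q d : ℕ} (hl : l.Prime) (hq : q.Prime) (hl8 : l % 8 = 1) (hq4 : q % 4 = 3)
    (hd : d ∣ 2 * l * q) : d % 8 ≠ 5 := by
  have hlq : (l * q) % 8 = q % 8 := by rw [Nat.mul_mod, hl8, one_mul, Nat.mod_mod]
  have h2l : (2 * l) % 8 = 2 := by rw [Nat.mul_mod, hl8]
  have h2q : (2 * q) % 8 = 6 := by rw [Nat.mul_mod]; omega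
  have h2lq : (2 * l * q) % 8 = 6 := by rw [mul_assoc, Nat.mul_mod, hlq]; omega
  rcases (dvd_mul_three_iff Nat.prime_two hl hq).mp hd with rfl | rfl | rfl | rfl | rfl | rfl | rfl | rfl <;> omega

/-- For `n = 2lq` (`l ≡ 1 (mod 8)`, `q ≡ 3 (mod 4)`) the only divisor `d ≡ 6 (mod 8)` of `n` other than `n` is `2q`, with cofactor `l`.
[cite: TianYuanZhang2017, §3.1 (p0011 L67–L70)] -/
theorem eq_two_mul_of_dvd_of_mod_eight_six {l q d : ℕ} (hl : l.Prime) (hq : q.Prime) (hl8 : l % 8 = 1) (hq4 : q % 4 = 3)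
    (hd : d ∣ 2 * l * q) (hd6 : d % 8 = 6) (hdn : d ≠ 2 * l * q) : d = 2 * q := by
  have hlq : (l * q) % 8 = q % 8 := by rw [Nat.mul_mod, hl8, one_mul, Nat.mod_mod]
  have h2l : (2 * l) % 8 = 2 := by rw [Nat.mul_mod, hl8]
  rcases (dvd_mul_three_iff Nat.prime_two hl hq).mp hd with rfl | rfl | rfl | rfl | rfl | rfl | rfl | rfl <;> first | rfl | omega

/-- **THE TOP-BLOCK REDUCTION for `n = 2lq`** (`l ≡ 1 (mod 8)`, `q ≡ 3 (mod 4)` primes, `n` square-free; the displayed recursion, the CM-point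
layer on every block, and `𝓛(l)` EVEN — Thm 1.1 with Monsky: `s(l) = 2` for `l ≡ 1 (mod 8)`): for EVERY automorphism `g` of `ℍ′_n`,
`g·g·P(n) = P(n) + [g(√−n) = √−n ∧ (g·g)^{g(n)} ≡ σ_n]·τ(1)` — in g8's formula (`galPt_mul_self_P_eq_add_even`) the chains through blocks `≡ 5` are
empty, the blocks `q, lq ≡ 3, 7` never move, and the one proper block `2q ≡ 6` carries the even coefficient `|𝓛(l)|`.
[cite: TianYuanZhang2017, §3.1 (p0011 L53–L73), Prop. 3.2 (2), Thm. 3.6 (2), proof of Lemma 3.21 (p0020 L27–L63), Thm. 1.1] -/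
theorem galPt_mul_self_P_eq_add_top_two_primes (hsq : Squarefree n) {l q : ℕ} (hl : l.Prime) (hq : q.Prime)
    (hn : n = 2 * l * q) (hl8 : l % 8 = 1) (hq4 : q % 4 = 3) (hrec : D.recursion)
    (z : ℕ → APoint D.H) (Φ : ℕ → Finset (D.H ≃ₐ[ℚ] D.H)) (ΓH ΓH' : ℕ → Subgroup (D.H ≃ₐ[ℚ] D.H))
    (σ : ℕ → (D.H ≃ₐ[ℚ] D.H)) (c : D.H ≃ₐ[ℚ] D.H) (hc : D.ConjSpec c)
    (hblock : ∀ d ∈ n.divisors, ((d % 8 = 5 ∨ d % 8 = 6) → D.CMBlockSpec d (z d) (Φ d) (ΓH d) (ΓH' d) (σ d) c) ∧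
      (d % 8 = 7 → D.SevenBlockSpec d))
    (hLl : Even (D.scriptL l)) (g : D.H ≃ₐ[ℚ] D.H) :
    D.galPt (g * g) (D.P n) = D.P n +
      (if g (D.sqrtNeg n) = D.sqrtNeg n ∧ (g * g) ^ gK n * (σ n)⁻¹ ∈ ΓH' n then 1 else 0) • (tauOne : APoint D.H) := by
  have hn0 : n ≠ 0 := hsq.ne_zero
  have h2q8 : (2 * q) % 8 = 6 := by rw [Nat.mul_mod]; omega
  have h6 : n % 8 = 6 := by
    rw [hn, mul_assoc, Nat.mul_mod, show (l * q) % 8 = q % 8 by rw [Nat.mul_mod, hl8, one_mul, Nat.mod_mod]]; omega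
  have hdvd_of_rec : ∀ {d d' : ℕ}, d' ∈ recursionIndex d → d' ∣ d := fun hd' =>
    Nat.dvd_of_mem_divisors (Finset.mem_filter.mp hd').1
  rw [galPt_mul_self_P_eq_add_even D hsq h6 hrec z Φ ΓH ΓH' σ c hc hblock g]
  -- the chains through blocks `≡ 5` are empty
  have hS2 : ∑ d ∈ recursionIndex n, ∑ d' ∈ (recursionIndex d).filter (fun d' => d' % 8 = 5),
      (D.scriptL (n / d)).natAbs * (D.scriptL (d / d')).natAbs *
        (if (d' % 8 = 5 ∨ d' % 8 = 6) ∧ g (D.sqrtNeg d') = D.sqrtNeg d' ∧ (g * g) ^ gK d' * (σ d')⁻¹ ∈ ΓH' d' then 1 else 0) = 0 := by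
    refine Finset.sum_eq_zero fun d hd => Finset.sum_eq_zero fun d' hd' => ?_
    exfalso
    obtain ⟨hd'r, hd'5⟩ := Finset.mem_filter.mp hd'
    have hdvd : d' ∣ 2 * l * q := hn ▸ (hdvd_of_rec hd'r).trans (hdvd_of_rec hd)
    exact mod_eight_ne_five_of_dvd hl hq hl8 hq4 hdvd hd'5
  have hS3 : ∑ d ∈ (recursionIndex n).filter (fun d => d % 2 = 0), ∑ d' ∈ recursionIndex d,
      ∑ e ∈ (recursionIndex d').filter (fun e => e % 8 = 5),
        (D.scriptL (n / d)).natAbs * (D.scriptL (d / d')).natAbs * (D.scriptL (d' / e)).natAbs *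
          (if (e % 8 = 5 ∨ e % 8 = 6) ∧ g (D.sqrtNeg e) = D.sqrtNeg e ∧ (g * g) ^ gK e * (σ e)⁻¹ ∈ ΓH' e then 1 else 0) = 0 := by
    refine Finset.sum_eq_zero fun d hd => Finset.sum_eq_zero fun d' hd' => Finset.sum_eq_zero fun e he => ?_
    exfalso
    obtain ⟨hdr, -⟩ := Finset.mem_filter.mp hd
    obtain ⟨her, he5⟩ := Finset.mem_filter.mp he
    have hdvd : e ∣ 2 * l * q := hn ▸ ((hdvd_of_rec her).trans (hdvd_of_rec hd')).trans (hdvd_of_rec hdr)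
    exact mod_eight_ne_five_of_dvd hl hq hl8 hq4 hdvd he5
  -- the single chains: only `2q ≡ 6` can move, with the even coefficient `|𝓛(l)|`
  have hS1 : Even (∑ d ∈ recursionIndex n, (D.scriptL (n / d)).natAbs *
      (if (d % 8 = 5 ∨ d % 8 = 6) ∧ g (D.sqrtNeg d) = D.sqrtNeg d ∧ (g * g) ^ gK d * (σ d)⁻¹ ∈ ΓH' d then 1 else 0)) := by
    refine Finset.even_sum _ fun d hd => ?_
    by_cases hcond : (d % 8 = 5 ∨ d % 8 = 6) ∧ g (D.sqrtNeg d) = D.sqrtNeg d ∧ (g * g) ^ gK d * (σ d)⁻¹ ∈ ΓH' d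
    · rw [if_pos hcond, mul_one]
      have hdvd : d ∣ 2 * l * q := hn ▸ hdvd_of_rec hd
      have hd6 : d % 8 = 6 := by
        rcases hcond.1 with h5 | h6'
        · exact absurd h5 (mod_eight_ne_five_of_dvd hl hq hl8 hq4 hdvd)
        · exact h6'
      have hgt : 1 < n / d := (Finset.mem_filter.mp hd).2.2.2
      have hdn : d ≠ 2 * l * q := by
        rintro rfl
        rw [← hn, Nat.div_self (Nat.pos_of_ne_zero hn0)] at hgt
        exact lt_irrefl 1 hgt
      have hd2q : d = 2 * q := eq_two_mul_of_dvd_of_mod_eight_six hl hq hl8 hq4 hdvd hd6 hdn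
      have hnd : n / d = l := by
        rw [hd2q, hn, show 2 * l * q = (2 * q) * l by ring]
        exact Nat.mul_div_cancel_left l (by omega)
      rw [hnd]
      exact Int.natAbs_even.mpr hLl
    · rw [if_neg hcond, mul_zero]
      exact ⟨0, rfl⟩
  obtain ⟨r, hr⟩ := hS1
  have htop : (if (n % 8 = 5 ∨ n % 8 = 6) ∧ g (D.sqrtNeg n) = D.sqrtNeg n ∧ (g * g) ^ gK n * (σ n)⁻¹ ∈ ΓH' n then (1 : ℕ) else 0) =
      (if g (D.sqrtNeg n) = D.sqrtNeg n ∧ (g * g) ^ gK n * (σ n)⁻¹ ∈ ΓH' n then 1 else 0) := by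
    by_cases hh : g (D.sqrtNeg n) = D.sqrtNeg n ∧ (g * g) ^ gK n * (σ n)⁻¹ ∈ ΓH' n
    · rw [if_pos hh, if_pos ⟨Or.inr h6, hh⟩]
    · rw [if_neg hh, if_neg (fun hh' => hh hh'.2)]
  rw [hS2, hS3, add_zero, add_zero, hr, htop, show r + r = 2 * r by ring, nsmul_tauOne_eq_mod_two,
    Nat.add_mul_mod_self_left, ← nsmul_tauOne_eq_mod_two]

/-- **SQUARE SILENCE ON `n = 2lq` FROM A WITNESS**: if moreover some automorphism `e` of `ℍ′_n` is trivial on `L_n(i)`, has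
`e·e ∈ Gal(ℍ′_n/H′_n)` and `e ∉ Gal(ℍ′_n/H_n)`, then `g·g·P(n) = P(n)` for EVERY automorphism `g` (§1 on the top block + §2).
[cite: TianYuanZhang2017, §3.1 (p0011 L1–L13, L53–L73), Prop. 3.2 (2), Thm. 3.6 (2), proof of Lemma 3.21 (p0020 L27–L63), Thm. 1.1] -/
theorem galPt_sq_genusPoint_eq_of_witness (hsq : Squarefree n) {l q : ℕ} (hl : l.Prime) (hq : q.Prime)
    (hn : n = 2 * l * q) (hl8 : l % 8 = 1) (hq4 : q % 4 = 3) (hrec : D.recursion)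
    (z : ℕ → APoint D.H) (Φ : ℕ → Finset (D.H ≃ₐ[ℚ] D.H)) (ΓH ΓH' : ℕ → Subgroup (D.H ≃ₐ[ℚ] D.H))
    (σ : ℕ → (D.H ≃ₐ[ℚ] D.H)) (c : D.H ≃ₐ[ℚ] D.H) (hc : D.ConjSpec c)
    (hblock : ∀ d ∈ n.divisors, ((d % 8 = 5 ∨ d % 8 = 6) → D.CMBlockSpec d (z d) (Φ d) (ΓH d) (ΓH' d) (σ d) c) ∧
      (d % 8 = 7 → D.SevenBlockSpec d))
    (hLl : Even (D.scriptL l)) {e : D.H ≃ₐ[ℚ] D.H} (heL : D.TrivialOnL n e) (hee : e * e ∈ ΓH' n) (heH : e ∉ ΓH n)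
    (g : D.H ≃ₐ[ℚ] D.H) : D.galPt (g * g) (D.P n) = D.P n := by
  have hnn : n ∈ n.divisors := Nat.mem_divisors_self n hsq.ne_zero
  have h6 : n % 8 = 6 := by
    rw [hn, mul_assoc, Nat.mul_mod, show (l * q) % 8 = q % 8 by rw [Nat.mul_mod, hl8, one_mul, Nat.mod_mod]]; omega
  have hn1 : 1 < n := by omega
  have hχ := not_sqChi_of_trivialOnL_involution D hnn hn1 ((hblock n hnn).1 (Or.inr h6)) heL hee heH g
  rw [galPt_mul_self_P_eq_add_top_two_primes D hsq hl hq hn hl8 hq4 hrec z Φ ΓH ΓH' σ c hc hblock hLl g,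
    if_neg (fun hh => hχ hh.2), zero_smul, add_zero]

/-! ## §3 The witness on the `s = 3` class: the Frobenius involution of the prime `l ≡ 1 (mod 8)` with `(l/q) = 1` -/

/-- `(−2/l) = 1` for a prime `l ≡ 1 (mod 8)`. [cite: Cox2013, §1 (1.13)] -/
theorem jacobiSym_neg_two_eq_one {l : ℕ} (hl : l.Prime) (hl8 : l % 8 = 1) : jacobiSym (-2) l = 1 := by
  have hodd : Odd l := hl.odd_of_ne_two (by omega)
  rw [jacobiSym.at_neg_two hodd, ZMod.χ₈'_nat_eq_if_mod_eight]
  have : l % 2 ≠ 0 := by omega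
  simp [this, hl8]

/-- `(−1/l) = 1` for a prime `l ≡ 1 (mod 4)`. [cite: Cox2013, §1 (1.13)] -/
theorem jacobiSym_neg_one_eq_one {l : ℕ} (hl : l.Prime) (hl4 : l % 4 = 1) : jacobiSym (-1) l = 1 := by
  have hodd : Odd l := hl.odd_of_ne_two (by omega)
  rw [jacobiSym.at_neg_one hodd, ZMod.χ₄_nat_eq_if_mod_four]
  have : l % 2 ≠ 0 := by omega
  simp [this, hl4]

/-- `(√−a·√−b)² = (i·√−(ab))²` in `ℍ′_n` (`a, b, ab ∣ n`). [cite: TianYuanZhang2017, §3.1 (p0011 L60–L64)] -/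
theorem sqrtNeg_mul_sq {a b : ℕ} (ha : a ∈ n.divisors) (hb : b ∈ n.divisors) (hab : a * b ∈ n.divisors) :
    (D.sqrtNeg a * D.sqrtNeg b) ^ 2 = (D.im * D.sqrtNeg (a * b)) ^ 2 := by
  rw [mul_pow, mul_pow, D.sqrtNeg_sq a ha, D.sqrtNeg_sq b hb, D.im_sq, D.sqrtNeg_sq (a * b) hab]; push_cast; ring

/-- An automorphism fixing `i`, `√−a`, `√−b` fixes `√−(ab)`. [cite: TianYuanZhang2017, §3.1 (p0011 L60–L64)] -/
theorem apply_sqrtNeg_mul_eq {a b : ℕ} (ha : a ∈ n.divisors) (hb : b ∈ n.divisors) (hab : a * b ∈ n.divisors)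
    {φ : D.H ≃ₐ[ℚ] D.H} (hφi : φ D.im = D.im) (hφa : φ (D.sqrtNeg a) = D.sqrtNeg a) (hφb : φ (D.sqrtNeg b) = D.sqrtNeg b) :
    φ (D.sqrtNeg (a * b)) = D.sqrtNeg (a * b) := by
  have h1 : φ (D.im * D.sqrtNeg (a * b)) = D.im * D.sqrtNeg (a * b) := by
    rcases eq_or_eq_neg_of_sq_eq_sq' (sqrtNeg_mul_sq D ha hb hab).symm with e | e
    · rw [e, map_mul, hφa, hφb]
    · rw [e, map_neg, map_mul, hφa, hφb]
  rw [map_mul, hφi] at h1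
  exact mul_left_cancel₀ D.im_ne_zero h1

/-- An automorphism fixing `i`, `√−a`, `√−(ab)` fixes `√−b`. [cite: TianYuanZhang2017, §3.1 (p0011 L60–L64)] -/
theorem apply_sqrtNeg_eq_of_mul {a b : ℕ} (ha : a ∈ n.divisors) (hb : b ∈ n.divisors) (hab : a * b ∈ n.divisors)
    {φ : D.H ≃ₐ[ℚ] D.H} (hφi : φ D.im = D.im) (hφa : φ (D.sqrtNeg a) = D.sqrtNeg a)
    (hφab : φ (D.sqrtNeg (a * b)) = D.sqrtNeg (a * b)) : φ (D.sqrtNeg b) = D.sqrtNeg b := by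
  have h1 : φ (D.sqrtNeg a * D.sqrtNeg b) = D.sqrtNeg a * D.sqrtNeg b := by
    rcases eq_or_eq_neg_of_sq_eq_sq' (sqrtNeg_mul_sq D ha hb hab).symm with e | e
    · rw [← e, map_mul, hφi, hφab]
    · rw [show D.sqrtNeg a * D.sqrtNeg b = -(D.im * D.sqrtNeg (a * b)) by rw [e, neg_neg], map_neg, map_mul, hφi, hφab]
  rw [map_mul, hφa] at h1
  exact mul_left_cancel₀ (D.sqrtNeg_ne_zero ha) h1

/-- **The Frobenius element of `𝔭_l` is trivial on `L_n(i)`** when `l ≡ 1 (mod 8)` and `(l/q) = 1` (`n = 2lq`): by Euler's criterion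
((F3) of the conductor-`4` Frobenius clause) it fixes `i` (`(−1/l) = 1`), `√−2` (`(−2/l) = 1`) and `√−q` (`(−q/l) = (q/l) = (l/q) = 1`), and
it fixes `√−n` (F1); hence it fixes every `√−d′`, `d′ ∣ n`.
[cite: TianYuanZhang2017, Prop. 3.2 (2) (p0010 L111–L113), §3.1 (p0011 L60–L66)] [cite: Cox2013, §5.C (5.20)/(5.22), §1 (1.13)–(1.15)] -/
theorem trivialOnL_of_frobenius_clause (hsq : Squarefree n) {l q : ℕ} (hl : l.Prime) (hq : q.Prime) (hlq : l ≠ q)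
    (hn : n = 2 * l * q) (hl8 : l % 8 = 1) (hq2 : q ≠ 2) (hleg : jacobiSym l q = 1)
    {φ : D.H ≃ₐ[ℚ] D.H} (hF1 : φ (D.sqrtNeg n) = D.sqrtNeg n) (hFi : φ D.im = (jacobiSym (-1) l) • D.im)
    (hFr : ∀ r : ℕ, r.Prime → r ∣ n → r ≠ l → φ (D.sqrtNeg r) = (jacobiSym (-(r : ℤ)) l) • D.sqrtNeg r) :
    D.TrivialOnL n φ := by
  have hn0 : n ≠ 0 := hsq.ne_zero
  have hnn : n ∈ n.divisors := Nat.mem_divisors_self n hn0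
  have hl2 : l ≠ 2 := by omega
  have h2d : 2 ∣ n := ⟨l * q, by rw [hn]; ring⟩
  have hld : l ∣ n := ⟨2 * q, by rw [hn]; ring⟩
  have hqd : q ∣ n := ⟨2 * l, by rw [hn]; ring⟩
  have h2ld : 2 * l ∣ n := ⟨q, by rw [hn]⟩
  have h2qd : 2 * q ∣ n := ⟨l, by rw [hn]; ring⟩
  have hlqd : l * q ∣ n := ⟨2, by rw [hn]; ring⟩
  have hm : ∀ {d : ℕ}, d ∣ n → d ∈ n.divisors := fun hd => Nat.mem_divisors.mpr ⟨hd, hn0⟩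
  have h2m := hm h2d; have hlm := hm hld; have hqm := hm hqd; have h2lm := hm h2ld; have h2qm := hm h2qd; have hlqm := hm hlqd
  have hnm' : 2 * q * l ∈ n.divisors := by rw [show 2 * q * l = n by rw [hn]; ring]; exact hnn
  have hql : jacobiSym q l = 1 := by
    rw [jacobiSym.quadratic_reciprocity_one_mod_four' (hq.odd_of_ne_two hq2) (by omega : l % 4 = 1)]
    exact hleg
  have hφi : φ D.im = D.im := by rw [hFi, jacobiSym_neg_one_eq_one hl (by omega), one_smul]
  have hφ2 : φ (D.sqrtNeg 2) = D.sqrtNeg 2 := by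
    rw [hFr 2 Nat.prime_two h2d hl2.symm, show (-((2 : ℕ) : ℤ)) = -2 by norm_num, jacobiSym_neg_two_eq_one hl hl8, one_smul]
  have hφq : φ (D.sqrtNeg q) = D.sqrtNeg q := by
    rw [hFr q hq hqd hlq.symm, neg_eq_neg_one_mul, jacobiSym.mul_left, jacobiSym_neg_one_eq_one hl (by omega), one_mul, hql,
      one_smul]
  have hφ2q : φ (D.sqrtNeg (2 * q)) = D.sqrtNeg (2 * q) := apply_sqrtNeg_mul_eq D h2m hqm h2qm hφi hφ2 hφq
  have hφn' : φ (D.sqrtNeg (2 * q * l)) = D.sqrtNeg (2 * q * l) := by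
    rw [show 2 * q * l = n by rw [hn]; ring]; exact hF1
  have hφl : φ (D.sqrtNeg l) = D.sqrtNeg l := apply_sqrtNeg_eq_of_mul D h2qm hlm hnm' hφi hφ2q hφn'
  have hφ2l : φ (D.sqrtNeg (2 * l)) = D.sqrtNeg (2 * l) := apply_sqrtNeg_mul_eq D h2m hlm h2lm hφi hφ2 hφl
  have hφlq : φ (D.sqrtNeg (l * q)) = D.sqrtNeg (l * q) := apply_sqrtNeg_mul_eq D hlm hqm hlqm hφi hφl hφq
  refine ⟨hφi, fun d' hd' hd1 => ?_⟩
  have hdvd : d' ∣ 2 * l * q := hn ▸ Nat.dvd_of_mem_divisors hd'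
  rcases (dvd_mul_three_iff Nat.prime_two hl hq).mp hdvd with rfl | rfl | rfl | rfl | rfl | rfl | rfl | rfl <;>
    first | omega | assumption | (rw [← hn]; exact hF1)

/-- **SQUARE SILENCE ON THE EVEN TWO-PRIME JUMP-ONE SECTORS.**  `n = 2lq` square-free with `l ≡ 1 (mod 8)`, `q ≡ 3 (mod 4)` and
`(l/q) = 1` (⟺ `#Sel₂(E_n/ℚ) = 2⁵` among `n = 2lq ≡ 6 (mod 8)`: sectors E1 `q ≡ 3` and E2 `q ≡ 7 (mod 8)`); the displayed recursion and
CM-point layer on every block; `𝓛(l)` even (Thm 1.1); and the Frobenius element `φ_l` of the ramified prime `𝔭_l` in `ℍ′_n/K_n` (conductor-`4`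
clause (F1)–(F3)) together with (F5) «`φ_l ∉ Gal(ℍ′_n/H_n)`» (Artin reciprocity for the Hilbert class field: `𝔭_l` is not principal, `l < n`).
Then **`g·g·P(n) = P(n)` for EVERY automorphism `g` of `ℍ′_n`** — the even twin of g10's Layer-1 silence (`…LayerOneSilenceOdd`).
[cite: TianYuanZhang2017, §3.1 (p0011 L1–L73), Prop. 3.2 (2), Thm. 3.6 (2), proof of Lemma 3.21 (p0020 L27–L63), Thm. 1.1]
[cite: Cox2013, §5.C Lemma 5.19, (5.22), Cor. 5.21, §9.A (pp. 180–181)] -/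
theorem galPt_sq_genusPoint_eq_two_primes_even (hsq : Squarefree n) {l q : ℕ} (hl : l.Prime) (hq : q.Prime) (hlq : l ≠ q)
    (hn : n = 2 * l * q) (hl8 : l % 8 = 1) (hq4 : q % 4 = 3) (hleg : jacobiSym l q = 1) (hrec : D.recursion)
    (z : ℕ → APoint D.H) (Φ : ℕ → Finset (D.H ≃ₐ[ℚ] D.H)) (ΓH ΓH' : ℕ → Subgroup (D.H ≃ₐ[ℚ] D.H))
    (σ : ℕ → (D.H ≃ₐ[ℚ] D.H)) (c : D.H ≃ₐ[ℚ] D.H) (hc : D.ConjSpec c)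
    (hblock : ∀ d ∈ n.divisors, ((d % 8 = 5 ∨ d % 8 = 6) → D.CMBlockSpec d (z d) (Φ d) (ΓH d) (ΓH' d) (σ d) c) ∧
      (d % 8 = 7 → D.SevenBlockSpec d))
    (hLl : Even (D.scriptL l))
    (hFrobl : ∃ φ : D.H ≃ₐ[ℚ] D.H, φ (D.sqrtNeg n) = D.sqrtNeg n ∧ φ * φ ∈ ΓH' n ∧ φ D.im = (jacobiSym (-1) l) • D.im ∧
      (∀ r : ℕ, r.Prime → r ∣ n → r ≠ l → φ (D.sqrtNeg r) = (jacobiSym (-(r : ℤ)) l) • D.sqrtNeg r) ∧ φ ∉ ΓH n)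
    (g : D.H ≃ₐ[ℚ] D.H) : D.galPt (g * g) (D.P n) = D.P n := by
  obtain ⟨φ, hF1, hF2, hFi, hFr, hF5⟩ := hFrobl
  have heL : D.TrivialOnL n φ := trivialOnL_of_frobenius_clause D hsq hl hq hlq hn hl8 (by omega) hleg hF1 hFi hFr
  exact galPt_sq_genusPoint_eq_of_witness D hsq hl hq hn hl8 hq4 hrec z Φ ΓH ΓH' σ c hc hblock hLl heL hF2 hF5 g

end Summit.BirchSwinnertonDyer.PrintCf2.SquareSilenceEven

end
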